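import Literature.MathematicalPhysics.QuantumLattice.HubbardSignGaugeBoundSharp
import Literature.MathematicalPhysics.QuantumLattice.HubbardGaugeBoundTTPrime
import HarnessLib

/-!
# Koma–Tasaki's sign-gauge bound with the printed constant, two hopping graphs (`t–t'` model)

T. Koma, H. Tasaki, *Decay of superconducting and magnetic correlations in one- and
two-dimensional Hubbard models*, Phys. Rev. Lett. **68** (1992) 3248–3251, eqs. (5)–(12), the
last paragraph of the proof (magnetic case) and note 9 (finite-range hopping); H. Xu et al.,
Science **384** (2024) eadh7691, eq. (1) (the `t–t'` Hamiltonian).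

`HubbardSignGaugeBoundSharp` carries Koma–Tasaki's eq. (11) *as printed* (hopping norm
`‖c†_{uσ}c_{vσ} + h.c.‖ ≤ 1`, no spin factor) through every SIGN gauge `θ_{uσ} = -iε_σψ_u`,
`ε_σ = ±1`, for ONE hopping graph. Here the same is done for a sum of two Hubbard Hamiltonians on
two hopping graphs over the same sites — the grand-canonical `t–t'` model
`H_{t,t'}(U) - μN = (H_{n.n.}(t,U) - μN) + H_{diag}(t',0)` (`hubbardTorusTT'_sub_chemicalPotential`):
the gauge transformation acts summand-wise, the Hermitian perturbations add, and so do their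
printed norm bounds (note 9 of the source).

## Main statements

* `gauge_conj_hamiltonianWith_add_conjTranspose_signWeights` — eqs. (7), (9) for a sign gauge in
  the form `W H W⁻¹ + (W H W⁻¹)ᴴ = 2 (H + V)`, `V = -t·T(cosh(ψ_u - ψ_v) - 1)`;
* `norm_gibbsState_two_graphs_le_signWeights` — eqs. (6), (10)–(12) for
  `H = H_{G₁}(t₁,U₁,μ₁) + H_{G₂}(t₂,U₂,μ₂)` and a sign-gauge eigen-operator `A`:
  `|⟨A⟩_β| ≤ |κ| ‖A‖ exp[β (|t₁| Σ_{G₁} + |t₂| Σ_{G₂})(cosh(ψ_u - ψ_v) - 1)]`;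
* `norm_gibbsState_hubbardTorusTT'_le_signWeights` — the same for the torus `t–t'` model;
* `norm_thermalCorr_siteSpinPlus_ttPrime_le_sharp` — the a priori bound for `⟨S⁺_x S⁻_y⟩` of the
  `t–t'` model (gauge charge `2`, cost `β(|t| Σ_{n.n.} + |t'| Σ_{diag})`);
* `norm_thermalCorr_creation_annihilation_ttPrime_le_sharp` — the same for `⟨c†_{xσ} c_{yσ}⟩`
  (gauge charge `1`).

## Mathlib search

Nothing model-specific in Mathlib. Tree: `HubbardSignGaugeBoundSharp` (`signWeights`,
`gauge_hermitianPart_sub_hamiltonianWith_signWeights`), `HubbardGaugeBoundTTPrime`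
(`hubbardTorusTT'_sub_chemicalPotential`, the two-graph pattern for the charge gauge),
`HubbardHubbardModelPairDecayProofs.norm_gibbsState_le_of_gauge`,
`HubbardGaugeBoundSharp.norm_hoppingPerturbation_le_sharp`,
`HubbardHubbardModelKomaTasakiProofs` (`gauge_conj_creation_mul_annihilation`, `gauge_conj_mul`,
`diagonal_prod_exp_mul_diagonal_prod_exp_neg`).
-/

noncomputable section

namespace Literature.MathematicalPhysics.QuantumLattice

open Matrix Finset NormedSpace
open scoped Matrix.Norms.L2Operator ComplexOrder

/-! ### Sign gauges and two hopping graphs -/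

section TwoGraphs

variable {Λ : Type*} [LinearOrder Λ] [Fintype Λ]

omit [LinearOrder Λ] [Fintype Λ] in
/-- The sign-gauge weight of the orbital `(x, σ)` is `ε_σ ψ_x`. [folklore] -/
private theorem signWeights_orb' (ε : Fin 2 → ℝ) (ψ : Λ → ℝ) (x : Λ) (σ : Fin 2) :
    signWeights ε ψ (orb x σ) = ε σ * ψ x := by
  simp [signWeights, orb]

/-- **Koma–Tasaki eqs. (7), (9) for a sign gauge, conjugation form**: with
`W = G_{e^v}`, `v_{(u,σ)} = ε_σ ψ_u`, `ε_σ = ±1`,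
`W (H - μN) W⁻¹ + (W (H - μN) W⁻¹)ᴴ = 2 ((H - μN) - t·T(cosh(ψ_u - ψ_v) - 1))`.
Koma–Tasaki, PRL 68 (1992) 3248, eqs. (7), (9). [cite: KomaTasakiPRL1992, eqs. (7) and (9)] -/
theorem gauge_conj_hamiltonianWith_add_conjTranspose_signWeights (G : SimpleGraph Λ)
    [DecidableRel G.Adj] (ε : Fin 2 → ℝ) (hε : ∀ σ, ε σ = 1 ∨ ε σ = -1) (ψ : Λ → ℝ)
    (t U μ : ℝ) :
    diagonal (fun s : Finset (Orb Λ) => ∏ i ∈ s, (Real.exp (signWeights ε ψ i) : ℂ)) *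
        hamiltonianWith G t U μ *
        diagonal (fun s : Finset (Orb Λ) => ∏ i ∈ s, (Real.exp (-signWeights ε ψ i) : ℂ)) +
      (diagonal (fun s : Finset (Orb Λ) => ∏ i ∈ s, (Real.exp (signWeights ε ψ i) : ℂ)) *
        hamiltonianWith G t U μ *
        diagonal (fun s : Finset (Orb Λ) => ∏ i ∈ s, (Real.exp (-signWeights ε ψ i) : ℂ)))ᴴ =
      (2 : ℂ) • (hamiltonianWith G t U μ +
        -(t : ℂ) • hoppingForm G (fun u v => Real.cosh (ψ u - ψ v) - 1)) := by
  rw [← gauge_hermitianPart_sub_hamiltonianWith_signWeights G ε hε ψ t U μ]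
  module

variable (G₁ : SimpleGraph Λ) [DecidableRel G₁.Adj] (G₂ : SimpleGraph Λ) [DecidableRel G₂.Adj]

/-- **Koma–Tasaki bound for a two-graph Hubbard Gibbs state, sign gauge, printed constant**
(eqs. (6), (10)–(12) with the hopping norm of eq. (11) as printed and the finite-range remark of
note 9): for `H = H_{G₁}(t₁,U₁,μ₁) + H_{G₂}(t₂,U₂,μ₂)` on the same orbitals, a sign gauge
`v = ε ⊗ ψ` (`ε_σ = ±1`), `β ≥ 0`, and an observable with `G_{e^v} A G_{e^v}⁻¹ = κ A`:
`|⟨A⟩_β| ≤ |κ| ‖A‖ exp[β (|t₁| Σ_u Σ_v [u ∼₁ v] + |t₂| Σ_u Σ_v [u ∼₂ v]) (cosh(ψ_u - ψ_v) - 1)]`.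
Koma–Tasaki, PRL 68 (1992) 3248, eqs. (6), (10)–(12), note 9.
[cite: KomaTasakiPRL1992, eqs. (6)–(12) and note 9] -/
theorem norm_gibbsState_two_graphs_le_signWeights (ε : Fin 2 → ℝ)
    (hε : ∀ σ, ε σ = 1 ∨ ε σ = -1) (ψ : Λ → ℝ) (t₁ U₁ μ₁ t₂ U₂ μ₂ : ℝ) {β : ℝ} (hβ : 0 ≤ β)
    (A : Matrix (Finset (Orb Λ)) (Finset (Orb Λ)) ℂ) (κ : ℂ)
    (hA : diagonal (fun s : Finset (Orb Λ) => ∏ i ∈ s, (Real.exp (signWeights ε ψ i) : ℂ)) *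
        A * diagonal (fun s : Finset (Orb Λ) =>
          ∏ i ∈ s, (Real.exp (-signWeights ε ψ i) : ℂ)) = κ • A) :
    ‖gibbsState β (hamiltonianWith G₁ t₁ U₁ μ₁ + hamiltonianWith G₂ t₂ U₂ μ₂) A‖ ≤
      ‖κ‖ * ‖A‖ * Real.exp (β * (|t₁| * (∑ u : Λ, ∑ v : Λ,
            if G₁.Adj u v then (Real.cosh (ψ u - ψ v) - 1) else 0) +
          |t₂| * ∑ u : Λ, ∑ v : Λ,
            if G₂.Adj u v then (Real.cosh (ψ u - ψ v) - 1) else 0)) := by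
  have e₁ := gauge_conj_hamiltonianWith_add_conjTranspose_signWeights G₁ ε hε ψ t₁ U₁ μ₁
  have e₂ := gauge_conj_hamiltonianWith_add_conjTranspose_signWeights G₂ ε hε ψ t₂ U₂ μ₂
  set W : Matrix (Finset (Orb Λ)) (Finset (Orb Λ)) ℂ :=
    diagonal (fun s : Finset (Orb Λ) => ∏ i ∈ s, (Real.exp (signWeights ε ψ i) : ℂ)) with hW
  set W' : Matrix (Finset (Orb Λ)) (Finset (Orb Λ)) ℂ :=
    diagonal (fun s : Finset (Orb Λ) => ∏ i ∈ s, (Real.exp (-signWeights ε ψ i) : ℂ)) with hW'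
  set H₁ : Matrix (Finset (Orb Λ)) (Finset (Orb Λ)) ℂ := hamiltonianWith G₁ t₁ U₁ μ₁ with hH₁
  set H₂ : Matrix (Finset (Orb Λ)) (Finset (Orb Λ)) ℂ := hamiltonianWith G₂ t₂ U₂ μ₂ with hH₂
  set V₁ : Matrix (Finset (Orb Λ)) (Finset (Orb Λ)) ℂ :=
    -(t₁ : ℂ) • hoppingForm G₁ (fun u v => Real.cosh (ψ u - ψ v) - 1) with hV₁
  set V₂ : Matrix (Finset (Orb Λ)) (Finset (Orb Λ)) ℂ :=
    -(t₂ : ℂ) • hoppingForm G₂ (fun u v => Real.cosh (ψ u - ψ v) - 1) with hV₂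
  have h1 : W * W' = 1 := diagonal_prod_exp_mul_diagonal_prod_exp_neg (signWeights ε ψ)
  have h2 : W' * W = 1 := diagonal_prod_exp_neg_mul_diagonal_prod_exp (signWeights ε ψ)
  have hD : IsUnit W := ⟨⟨W, W', h1, h2⟩, rfl⟩
  have hWinv : W⁻¹ = W' := inv_eq_right_inv h1
  have hH : (H₁ + H₂).IsHermitian :=
    (isHermitian_hamiltonianWith G₁ t₁ U₁ μ₁).add (isHermitian_hamiltonianWith G₂ t₂ U₂ μ₂)
  have hA' : W * A * W⁻¹ = κ • A := by rw [hWinv]; exact hA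
  have hV : W * (H₁ + H₂) * W⁻¹ + (W * (H₁ + H₂) * W⁻¹)ᴴ =
      (2 : ℂ) • ((H₁ + H₂) + (V₁ + V₂)) := by
    rw [hWinv, Matrix.mul_add, Matrix.add_mul, conjTranspose_add]
    calc W * H₁ * W' + W * H₂ * W' + ((W * H₁ * W')ᴴ + (W * H₂ * W')ᴴ)
        = (W * H₁ * W' + (W * H₁ * W')ᴴ) + (W * H₂ * W' + (W * H₂ * W')ᴴ) := by abel
      _ = (2 : ℂ) • (H₁ + V₁) + (2 : ℂ) • (H₂ + V₂) := by rw [e₁, e₂]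
      _ = (2 : ℂ) • ((H₁ + H₂) + (V₁ + V₂)) := by module
  have hc : ‖V₁ + V₂‖ ≤ |t₁| * (∑ u : Λ, ∑ v : Λ,
        if G₁.Adj u v then (Real.cosh (ψ u - ψ v) - 1) else 0) +
      |t₂| * ∑ u : Λ, ∑ v : Λ, if G₂.Adj u v then (Real.cosh (ψ u - ψ v) - 1) else 0 :=
    (norm_add_le _ _).trans (add_le_add (norm_hoppingPerturbation_le_sharp G₁ ψ t₁)
      (norm_hoppingPerturbation_le_sharp G₂ ψ t₂))
  exact norm_gibbsState_le_of_gauge hH hD hA' hV hc hβ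

end TwoGraphs

/-! ### The `t–t'` Hubbard model on the square torus -/

section Torus

open Literature.Probability.LatticeModels

variable {L : ℕ} [NeZero L]

/-- The nearest-neighbour bond sum of a lifted site function equals the bond sum on `(ℤ/Lℤ)²`.
[folklore] -/
private theorem sum_sum_fermionTorusGraph_cosh_eq₂ (ψ : TorusSite 2 L → ℝ) :
    (∑ u : FermionTorus 2 L, ∑ v : FermionTorus 2 L,
      if (fermionTorusGraph 2 L).Adj u v then
        (Real.cosh (ψ (FermionTorus.toTorusSite u) - ψ (FermionTorus.toTorusSite v)) - 1)
      else 0) =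
      ∑ a : TorusSite 2 L, ∑ b : TorusSite 2 L,
        if (torusGraph 2 L).Adj a b then (Real.cosh (ψ a - ψ b) - 1) else 0 := by
  refine Fintype.sum_equiv FermionTorus.equivTorusSite _ _ fun u => ?_
  refine Fintype.sum_equiv FermionTorus.equivTorusSite _ _ fun v => ?_
  simp [FermionTorus.equivTorusSite]

/-- The diagonal bond sum of a lifted site function equals the diagonal bond sum on `(ℤ/Lℤ)²`.
[folklore] -/
private theorem sum_sum_fermionTorusDiagGraph_cosh_eq (ψ : TorusSite 2 L → ℝ) :
    (∑ u : FermionTorus 2 L, ∑ v : FermionTorus 2 L,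
      if (fermionTorusDiagGraph L).Adj u v then
        (Real.cosh (ψ (FermionTorus.toTorusSite u) - ψ (FermionTorus.toTorusSite v)) - 1)
      else 0) =
      ∑ a : TorusSite 2 L, ∑ b : TorusSite 2 L,
        if (torusDiagGraph L).Adj a b then (Real.cosh (ψ a - ψ b) - 1) else 0 := by
  refine Fintype.sum_equiv FermionTorus.equivTorusSite _ _ fun u => ?_
  refine Fintype.sum_equiv FermionTorus.equivTorusSite _ _ fun v => ?_
  simp [FermionTorus.equivTorusSite, fermionTorusDiagGraph, SimpleGraph.comap_adj]

/-- **Koma–Tasaki bound for the torus `t–t'` Gibbs state of a sign-gauge eigen-operator, printed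
constant**: for `ε_σ = ±1`, a real `ψ` on `(ℤ/Lℤ)²`, weights `v_{(u,σ)} = ε_σ ψ_u`, `β ≥ 0`, and
`A` with `‖A‖ ≤ 1`, `G_{e^v} A G_{e^v}⁻¹ = κ A`:
`|⟨A⟩_{β,L}| ≤ |κ| exp[β (|t| Σ_{n.n.} + |t'| Σ_{diag}) (cosh(ψ_u - ψ_{u'}) - 1)]`
(ordered adjacent pairs). Koma–Tasaki, PRL 68 (1992) 3248, eqs. (6)–(12), note 9; Xu et al.,
Science 384 (2024), eq. (1). [cite: KomaTasakiPRL1992, eqs. (6)–(12) and note 9] -/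
theorem norm_gibbsState_hubbardTorusTT'_le_signWeights [instDE : DecidableEq (FermionTorus 2 L)]
    (t t' U μ : ℝ) {β : ℝ} (hβ : 0 ≤ β)
    (ε : Fin 2 → ℝ) (hε : ∀ σ, ε σ = 1 ∨ ε σ = -1) (ψ : TorusSite 2 L → ℝ)
    (A : Matrix (Finset (Orb (FermionTorus 2 L))) (Finset (Orb (FermionTorus 2 L))) ℂ) (κ : ℂ)
    (hA : diagonal (fun s : Finset (Orb (FermionTorus 2 L)) => ∏ i ∈ s,
          (Real.exp (signWeights ε (fun u => ψ (FermionTorus.toTorusSite u)) i) : ℂ)) * A *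
        diagonal (fun s : Finset (Orb (FermionTorus 2 L)) => ∏ i ∈ s,
          (Real.exp (-signWeights ε (fun u => ψ (FermionTorus.toTorusSite u)) i) : ℂ)) =
        κ • A)
    (hAn : ‖A‖ ≤ 1) :
    ‖gibbsState β (hubbardTorusTT' L t t' U - (μ : ℂ) • totalNumber) A‖ ≤
      ‖κ‖ * Real.exp (β * (|t| * (∑ u : TorusSite 2 L, ∑ u' : TorusSite 2 L,
          (if (torusGraph 2 L).Adj u u' then Real.cosh (ψ u - ψ u') - 1 else 0)) +
        |t'| * ∑ u : TorusSite 2 L, ∑ u' : TorusSite 2 L,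
          (if (torusDiagGraph L).Adj u u' then Real.cosh (ψ u - ψ u') - 1 else 0))) := by
  obtain rfl : instDE = LinearOrder.toDecidableEq := Subsingleton.elim _ _
  letI instDE : DecidableEq (FermionTorus 2 L) := LinearOrder.toDecidableEq
  rw [hubbardTorusTT'_sub_chemicalPotential]
  have key := norm_gibbsState_two_graphs_le_signWeights (fermionTorusGraph 2 L)
    (fermionTorusDiagGraph L) ε hε (fun u => ψ (FermionTorus.toTorusSite u)) t U μ t' 0 0 hβ
    A κ hA
  rw [sum_sum_fermionTorusGraph_cosh_eq₂ ψ, sum_sum_fermionTorusDiagGraph_cosh_eq ψ] at key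
  refine key.trans ?_
  calc ‖κ‖ * ‖A‖ * Real.exp (β * (|t| * (∑ u : TorusSite 2 L, ∑ u' : TorusSite 2 L,
          (if (torusGraph 2 L).Adj u u' then Real.cosh (ψ u - ψ u') - 1 else 0)) +
        |t'| * ∑ u : TorusSite 2 L, ∑ u' : TorusSite 2 L,
          (if (torusDiagGraph L).Adj u u' then Real.cosh (ψ u - ψ u') - 1 else 0)))
      ≤ ‖κ‖ * 1 * Real.exp (β * (|t| * (∑ u : TorusSite 2 L, ∑ u' : TorusSite 2 L,
          (if (torusGraph 2 L).Adj u u' then Real.cosh (ψ u - ψ u') - 1 else 0)) +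
        |t'| * ∑ u : TorusSite 2 L, ∑ u' : TorusSite 2 L,
          (if (torusDiagGraph L).Adj u u' then Real.cosh (ψ u - ψ u') - 1 else 0))) := by
        gcongr
    _ = _ := by rw [mul_one]

/-- **Koma–Tasaki's a priori bound for the transverse spin correlation of the `t–t'` model,
printed constant**: for every real `ψ` on `(ℤ/Lℤ)²`, `β ≥ 0` and all `t, t', U, μ`,
`|⟨S⁺_x S⁻_y⟩_{β,L}| ≤ e^{-2(ψ_x - ψ_y)} exp[β (|t| Σ_{n.n.} + |t'| Σ_{diag}) (cosh(ψ_u - ψ_{u'}) - 1)]`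
(spin gauge `v_{(u,↑)} = -ψ_u`, `v_{(u,↓)} = +ψ_u`; eigenvalue `e^{-2(ψ_x - ψ_y)}`).
Koma–Tasaki, PRL 68 (1992) 3248, eqs. (6)–(12), the last paragraph of the proof (magnetic
case) and note 9. [cite: KomaTasakiPRL1992, eq. (12), magnetic case, and note 9] -/
theorem norm_thermalCorr_siteSpinPlus_ttPrime_le_sharp [instDE : DecidableEq (FermionTorus 2 L)]
    (t t' U μ : ℝ) {β : ℝ} (hβ : 0 ≤ β)
    (ψ : TorusSite 2 L → ℝ) (x y : TorusSite 2 L) :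
    ‖(hubbardTorusTT' L t t' U - (μ : ℂ) • totalNumber).thermalCorr β
        (siteSpinPlus x) (siteSpinPlus y)ᴴ‖ ≤
      Real.exp (-(2 * (ψ x - ψ y))) * Real.exp (β * (|t| *
          (∑ u : TorusSite 2 L, ∑ u' : TorusSite 2 L,
            (if (torusGraph 2 L).Adj u u' then Real.cosh (ψ u - ψ u') - 1 else 0)) +
        |t'| * ∑ u : TorusSite 2 L, ∑ u' : TorusSite 2 L,
            (if (torusDiagGraph L).Adj u u' then Real.cosh (ψ u - ψ u') - 1 else 0))) := by
  obtain rfl : instDE = LinearOrder.toDecidableEq := Subsingleton.elim _ _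
  letI instDE : DecidableEq (FermionTorus 2 L) := LinearOrder.toDecidableEq
  -- the spin-dependent sign pattern `ε = (-1, +1)`
  let ε : Fin 2 → ℝ := fun σ => if σ = 0 then -1 else 1
  have hε : ∀ σ, ε σ = 1 ∨ ε σ = -1 := fun σ => by
    simp only [ε]; split_ifs <;> simp
  set v : Orb (FermionTorus 2 L) → ℝ :=
    signWeights ε (fun u => ψ (FermionTorus.toTorusSite u)) with hvdef
  have hv0 : ∀ z : FermionTorus 2 L, v (orb z 0) = -ψ (FermionTorus.toTorusSite z) := by
    intro z; rw [hvdef, signWeights_orb']; simp [ε]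
  have hv1 : ∀ z : FermionTorus 2 L, v (orb z 1) = ψ (FermionTorus.toTorusSite z) := by
    intro z; rw [hvdef, signWeights_orb']; simp [ε]
  let X := FermionTorus.ofTorusSite x
  let Y := FermionTorus.ofTorusSite y
  let P : Matrix (Finset (Orb (FermionTorus 2 L))) (Finset (Orb (FermionTorus 2 L))) ℂ :=
    creation (orb X 0) * annihilation (orb X 1)
  let Q : Matrix (Finset (Orb (FermionTorus 2 L))) (Finset (Orb (FermionTorus 2 L))) ℂ :=
    creation (orb Y 1) * annihilation (orb Y 0)
  have hAeq : siteSpinPlus x * (siteSpinPlus y)ᴴ = P * Q := siteSpinPlus_mul_conjTranspose x y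
  have hWA := gauge_conj_mul v (gauge_conj_creation_mul_annihilation v (orb X 0) (orb X 1))
    (gauge_conj_creation_mul_annihilation v (orb Y 1) (orb Y 0))
  have hκn : ‖(Real.exp (v (orb X 0) - v (orb X 1)) : ℂ) *
      (Real.exp (v (orb Y 1) - v (orb Y 0)) : ℂ)‖ = Real.exp (-(2 * (ψ x - ψ y))) := by
    rw [norm_mul, Complex.norm_real, Complex.norm_real, Real.norm_eq_abs, Real.norm_eq_abs,
      abs_of_pos (Real.exp_pos _), abs_of_pos (Real.exp_pos _), ← Real.exp_add, hv0, hv1, hv0, hv1]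
    simp only [X, Y, FermionTorus.toTorusSite_ofTorusSite]
    ring_nf
  have hAn : ‖P * Q‖ ≤ 1 := by
    calc ‖P * Q‖ ≤ ‖P‖ * ‖Q‖ := l2_opNorm_mul _ _
      _ ≤ 1 * 1 := mul_le_mul (l2_opNorm_creation_mul_annihilation_le_one _ _)
          (l2_opNorm_creation_mul_annihilation_le_one _ _) (norm_nonneg _) zero_le_one
      _ = 1 := one_mul 1
  have core := norm_gibbsState_hubbardTorusTT'_le_signWeights t t' U μ hβ ε hε ψ (P * Q) _
    hWA hAn
  rw [hκn] at core
  rw [Matrix.thermalCorr, hAeq]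
  exact core

/-- **Koma–Tasaki's a priori bound for the one-particle Green's function of the `t–t'` model,
printed constant**: for every real `ψ` on `(ℤ/Lℤ)²`, `β ≥ 0`, all `t, t', U, μ`, sites `x, y` and
a spin `σ`,
`|⟨c†_{xσ} c_{yσ}⟩_{β,L}| ≤ e^{-(ψ_x - ψ_y)} exp[β (|t| Σ_{n.n.} + |t'| Σ_{diag}) (cosh(ψ_u - ψ_{u'}) - 1)]`
(charge gauge of eq. (5), gauge charge `1`). Koma–Tasaki, PRL 68 (1992) 3248, eqs. (5)–(12) and
note 9 (the method "applies to other correlation functions").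
[cite: KomaTasakiPRL1992, eqs. (8) and (12), note 9] -/
theorem norm_thermalCorr_creation_annihilation_ttPrime_le_sharp
    [instDE : DecidableEq (FermionTorus 2 L)] (t t' U μ : ℝ) {β : ℝ} (hβ : 0 ≤ β) (ψ : TorusSite 2 L → ℝ) (x y : TorusSite 2 L) (σ : Fin 2) :
    ‖(hubbardTorusTT' L t t' U - (μ : ℂ) • totalNumber).thermalCorr β
        (creation (orb (FermionTorus.ofTorusSite x) σ))
        (annihilation (orb (FermionTorus.ofTorusSite y) σ))‖ ≤
      Real.exp (-(ψ x - ψ y)) * Real.exp (β * (|t| *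
          (∑ u : TorusSite 2 L, ∑ u' : TorusSite 2 L,
            (if (torusGraph 2 L).Adj u u' then Real.cosh (ψ u - ψ u') - 1 else 0)) +
        |t'| * ∑ u : TorusSite 2 L, ∑ u' : TorusSite 2 L,
            (if (torusDiagGraph L).Adj u u' then Real.cosh (ψ u - ψ u') - 1 else 0))) := by
  obtain rfl : instDE = LinearOrder.toDecidableEq := Subsingleton.elim _ _
  letI instDE : DecidableEq (FermionTorus 2 L) := LinearOrder.toDecidableEq
  -- the charge gauge, sign pattern `ε ≡ -1`
  let ε : Fin 2 → ℝ := fun _ => -1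
  have hε : ∀ σ, ε σ = 1 ∨ ε σ = -1 := fun σ => Or.inr rfl
  set v : Orb (FermionTorus 2 L) → ℝ :=
    signWeights ε (fun u => ψ (FermionTorus.toTorusSite u)) with hvdef
  have hv : ∀ (z : FermionTorus 2 L) (τ : Fin 2),
      v (orb z τ) = -ψ (FermionTorus.toTorusSite z) := by
    intro z τ; rw [hvdef, signWeights_orb']; simp [ε]
  let X := FermionTorus.ofTorusSite x
  let Y := FermionTorus.ofTorusSite y
  let P : Matrix (Finset (Orb (FermionTorus 2 L))) (Finset (Orb (FermionTorus 2 L))) ℂ :=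
    creation (orb X σ) * annihilation (orb Y σ)
  have hWA := gauge_conj_creation_mul_annihilation v (orb X σ) (orb Y σ)
  have hκn : ‖(Real.exp (v (orb X σ) - v (orb Y σ)) : ℂ)‖ = Real.exp (-(ψ x - ψ y)) := by
    rw [Complex.norm_real, Real.norm_eq_abs, abs_of_pos (Real.exp_pos _), hv, hv]
    simp only [X, Y, FermionTorus.toTorusSite_ofTorusSite]
    ring_nf
  have hAn : ‖P‖ ≤ 1 := l2_opNorm_creation_mul_annihilation_le_one _ _
  have core := norm_gibbsState_hubbardTorusTT'_le_signWeights t t' U μ hβ ε hε ψ P _ hWA hAn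
  rw [hκn] at core
  rw [Matrix.thermalCorr]
  exact core

end Torus

end Literature.MathematicalPhysics.QuantumLattice

end
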